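import Literature.NumberTheory.GelbartRogawski1991.LocalUnitaryFrameTransport
import Literature.NumberTheory.GelbartRogawski1991.LocalUnitaryUndoubling
import HarnessLib

/-!
# The doubled frame `PD = P ⊕ P` on the models: `frameOp_{PD}` is `⊠`-multiplicative, `frameW_{PD}` preserves `ℓ_Δ` and `ℓ_Y`, and `frameMp_{PD}`
# carries movers of `ℓ_Δ` onto `ℓ_Y` to movers

Topic `NumberTheory/GelbartRogawski1991`; namespace `Literature.NumberTheory.GelbartRogawski1991.UnitaryDualPair.LocalSplitting` (home of ★ `deltaLagrangian`,
`lagrangianY`, `boxSB`-undoubling, `FrameTransport.*`).  KERNEL ONLY: theorems; no definition, no named fact, no `sorry`.  Cell `hodgecm-mathlib` (D-0151),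
programme P2 (crux H413 = stmt-HodgeConjecture-24833), brick **(FN)** «RATIONAL-FRAME NATURALITY of the CM local package» of the N3 road (lead B-p18 (g29),
2026-08-31; consumer: `LocalSplittingCMFrameNaturality`) — the MODEL LAYER, sibling of `LocalDoubledRationalFrameSiegel` (matrix layer).

THE OBJECTS (no new definition).  `T₀, T₀' ∈ M_n(F)`, a rational frame `P ∈ GL_n(F)`, the DOUBLED FRAME `PD := reindexGL e₂ (blockDiagGL (P, P)) ∈ GL_{n+n}(F)`
(hypothesis `hPD`), the tree's ★ `FrameTransport` operators at a finite place `v`: `frameLin_Q u = Q u` on `F_vᴺ`, `frameW_Q = frameLin_Q × frameLin_Q` on `𝕎_v`,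
`frameOp_Q f = f ∘ Q⁻¹` on `𝒮(F_vᴺ)`, `frameMp_Q : S̃p(𝕎_{T'}) ≃* S̃p(𝕎_T)` over `frameSp_Q = Ad(frameW_Q)` ([Weil1964, n° 13, n° 34]; [MoeglinVignerasWaldspurger1987,
Chap. 2 II Remarque (3)]).
* `coe_frameOp_apply_zero` ∕ `coe_frameOp_symm_apply` ∕ `coe_frameOp_symm_apply_zero` — `frameOp^{±1}` fix the value at `0` (any frame, any rank).
* `coe_framePv_pd` ∕ `coe_framePv_pd_inv` (`PD^{±1} = P^{±1} ⊕ P^{±1}` over `F_v`), `resL_resR_frameLin_pd(_symm)` (the `e₂`-halves of `PD^{±1} u`), hence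
  **`frameOp_pd_boxSB`**: `frameOp_{PD} (f₁ ⊠ f₂) = frameOp_P f₁ ⊠ frameOp_P f₂` — the box-compatibility hypothesis of ★ `apply_toRep_undoubleLoc_eq_of_box_transport`
  ([MoeglinVignerasWaldspurger1987, Chap. 2 II.1 Rem. (6)]).
* `map_frameW_lagrangianY` (any frame), **`map_frameW_pd_deltaLagrangian`** (`PD = P ⊕ P` respects «both halves equal», [HarrisKudlaSweet1996, §1 (1.11)]), whence
  **`map_proj_frameMp_pd_deltaLagrangian`**: if `π(m)` carries `ℓ_Δ` onto `ℓ_Y` in `𝕎^𝔻_{T₀'}` then `π(frameMp_{PD} m)` does so in `𝕎^𝔻_{T₀}` — the «ANY mover» slot of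
  ★ `parabolic_toRep_conj_localSplittingDatumCM` ([Kudla1994, §3 Thm. 3.1]).
Nothing of the cited sources is asserted; HC_CM is proved only modulo the printed citations until rung 0 closes.

## References
* [Weil1964] A. Weil, Acta Math. 111 (1964), n° 13 p. 160, n° 34.
* [MoeglinVignerasWaldspurger1987] LNM 1291 (1987), Chap. 2 I.7, II.1 Rem. (6), II Remarque (3).
* [HarrisKudlaSweet1996] M. Harris, S. Kudla, W. Sweet, J. AMS 9 (1996), §1 (1.9), (1.11).
* [Kudla1994] S. Kudla, Israel J. Math. 87 (1994), §3 Thm. 3.1.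
-/

set_option autoImplicit false
-- buildfix G11b-3 recipe (LEDGER B13-1/B13-3), as in the GelbartRogawski1991 siblings: elaborate sequentially.
set_option Elab.async false

noncomputable section

open scoped Matrix
open NumberField IsDedekindDomain Matrix
open Literature.RepresentationTheory.HeisenbergGroup
open Literature.NumberTheory.Automorphic Literature.NumberTheory.Automorphic.UnitaryGroup Literature.NumberTheory.Weil1964

namespace Literature.NumberTheory.GelbartRogawski1991.UnitaryDualPair.LocalSplitting

variable (F : Type) [Field F] [NumberField F] (v : HeightOneSpectrum (𝓞 F)) (n : ℕ) {T₀ T₀' : Matrix (Fin n) (Fin n) F}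
  (P : GL (Fin n) F) {PD : GL (Fin (n + n)) F} (hPD : PD = UnitaryGroup.reindexGL (e₂ n) (UnitaryGroup.blockDiagGL (P, P)))

/-! ## §1 `frameOp^{±1}` fix the value at `0` -/

/-- `(frameOp f)(0) = f(0)` (`frameOp f = f ∘ Q⁻¹` and `Q⁻¹ 0 = 0`). [cite: Weil1964, n° 13, p. 160] -/
theorem coe_frameOp_apply_zero {N : ℕ} (Q : GL (Fin N) F) (f : SchwartzBruhat (Fin N → v.adicCompletion F)) :
    ((FrameTransport.frameOp F v N Q f : SchwartzBruhat (Fin N → v.adicCompletion F)) : (Fin N → v.adicCompletion F) → ℂ) 0 =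
      (f : (Fin N → v.adicCompletion F) → ℂ) 0 := by
  rw [FrameTransport.coe_frameOp_apply, map_zero]

/-- formula: `(frameOp⁻¹ f)(u) = f(Q u)`. [cite: Weil1964, n° 13, p. 160] -/
theorem coe_frameOp_symm_apply {N : ℕ} (Q : GL (Fin N) F) (f : SchwartzBruhat (Fin N → v.adicCompletion F)) (u : Fin N → v.adicCompletion F) :
    (((FrameTransport.frameOp F v N Q).symm f : SchwartzBruhat (Fin N → v.adicCompletion F)) : (Fin N → v.adicCompletion F) → ℂ) u =
      (f : (Fin N → v.adicCompletion F) → ℂ) (FrameTransport.frameLin F v N Q u) := by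
  conv_rhs => rw [← (FrameTransport.frameOp F v N Q).apply_symm_apply f]
  rw [FrameTransport.coe_frameOp_apply, LinearEquiv.symm_apply_apply]

/-- `(frameOp⁻¹ f)(0) = f(0)`. [cite: Weil1964, n° 13, p. 160] -/
theorem coe_frameOp_symm_apply_zero {N : ℕ} (Q : GL (Fin N) F) (f : SchwartzBruhat (Fin N → v.adicCompletion F)) :
    (((FrameTransport.frameOp F v N Q).symm f : SchwartzBruhat (Fin N → v.adicCompletion F)) : (Fin N → v.adicCompletion F) → ℂ) 0 =
      (f : (Fin N → v.adicCompletion F) → ℂ) 0 := by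
  rw [coe_frameOp_symm_apply, map_zero]

/-! ## §2 `frameOp_{PD}` is `⊠`-multiplicative -/

/-- the `e₂`-halves of `(A ⊕ D) u`: `((A ⊕ D) u)|_L = A u|_L`, `((A ⊕ D) u)|_R = D u|_R`. [folklore] -/
private theorem resL_resR_reindex_fromBlocks_mulVec {K : Type*} [CommRing K] (A D : Matrix (Fin n) (Fin n) K) (u : Fin (n + n) → K) :
    resL (e₂ n) (Matrix.reindex (e₂ n) (e₂ n) (Matrix.fromBlocks A 0 0 D) *ᵥ u) = A *ᵥ resL (e₂ n) u ∧
      resR (e₂ n) (Matrix.reindex (e₂ n) (e₂ n) (Matrix.fromBlocks A 0 0 D) *ᵥ u) = D *ᵥ resR (e₂ n) u := by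
  rw [Matrix.reindex_apply, Matrix.submatrix_mulVec_equiv, Equiv.symm_symm, Matrix.fromBlocks_mulVec]
  simp only [Matrix.zero_mulVec, add_zero, zero_add]
  constructor
  · funext i
    rw [resL_apply, Function.comp_apply, Equiv.symm_apply_apply, Sum.elim_inl]
    rfl
  · funext i
    rw [resR_apply, Function.comp_apply, Equiv.symm_apply_apply, Sum.elim_inr]
    rfl

include hPD in
/-- the matrix of `PD` over `F_v`: `reindex e₂ e₂ (P_v ⊕ P_v)`. [cite: Weil1964, n° 34] -/
theorem coe_framePv_pd :
    ((FrameTransport.framePv F v (n + n) PD : GL (Fin (n + n)) (v.adicCompletion F)) : Matrix (Fin (n + n)) (Fin (n + n)) (v.adicCompletion F)) =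
      Matrix.reindex (e₂ n) (e₂ n) (Matrix.fromBlocks
        ((FrameTransport.framePv F v n P : GL (Fin n) (v.adicCompletion F)) : Matrix (Fin n) (Fin n) (v.adicCompletion F)) 0 0
        ((FrameTransport.framePv F v n P : GL (Fin n) (v.adicCompletion F)) : Matrix (Fin n) (Fin n) (v.adicCompletion F))) := by
  subst hPD
  change ((Matrix.GeneralLinearGroup.map (algebraMap F (v.adicCompletion F)) (UnitaryGroup.reindexGL (e₂ n) (UnitaryGroup.blockDiagGL (P, P))) :
    GL (Fin (n + n)) (v.adicCompletion F)) : Matrix (Fin (n + n)) (Fin (n + n)) (v.adicCompletion F)) = _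
  rw [UnitaryGroup.map_reindexGL, UnitaryGroup.map_blockDiagGL, UnitaryGroup.coe_reindexGL, UnitaryGroup.coe_blockDiagGL]
  rfl

include hPD in
/-- the matrix of `PD⁻¹` over `F_v`: `reindex e₂ e₂ (P_v⁻¹ ⊕ P_v⁻¹)`. [cite: Weil1964, n° 34] -/
theorem coe_framePv_pd_inv :
    (((FrameTransport.framePv F v (n + n) PD)⁻¹ : GL (Fin (n + n)) (v.adicCompletion F)) : Matrix (Fin (n + n)) (Fin (n + n)) (v.adicCompletion F)) =
      Matrix.reindex (e₂ n) (e₂ n) (Matrix.fromBlocks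
        (((FrameTransport.framePv F v n P)⁻¹ : GL (Fin n) (v.adicCompletion F)) : Matrix (Fin n) (Fin n) (v.adicCompletion F)) 0 0
        (((FrameTransport.framePv F v n P)⁻¹ : GL (Fin n) (v.adicCompletion F)) : Matrix (Fin n) (Fin n) (v.adicCompletion F))) := by
  subst hPD
  rw [FrameTransport.framePv, FrameTransport.framePv]
  simp only [← map_inv, Prod.inv_mk]
  exact coe_framePv_pd F v n P⁻¹ rfl

include hPD in
/-- the `e₂`-halves of `PD⁻¹ u` are `P⁻¹ (u|_L)`, `P⁻¹ (u|_R)` (read over `F_v`). [cite: Weil1964, n° 34] -/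
theorem resL_resR_frameLin_pd_symm (u : Fin (n + n) → v.adicCompletion F) :
    resL (e₂ n) ((FrameTransport.frameLin F v (n + n) PD).symm u) = (FrameTransport.frameLin F v n P).symm (resL (e₂ n) u) ∧
      resR (e₂ n) ((FrameTransport.frameLin F v (n + n) PD).symm u) = (FrameTransport.frameLin F v n P).symm (resR (e₂ n) u) := by
  rw [FrameTransport.frameLin_symm_apply, FrameTransport.frameLin_symm_apply, FrameTransport.frameLin_symm_apply, coe_framePv_pd_inv F v n P hPD]
  exact resL_resR_reindex_fromBlocks_mulVec n _ _ u

include hPD in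
/-- **`frameOp_{PD} (f₁ ⊠ f₂) = frameOp_P f₁ ⊠ frameOp_P f₂`**: the doubled frame operator `F ↦ F ∘ PD⁻¹` is `⊠`-multiplicative (`PD⁻¹ = P⁻¹ ⊕ P⁻¹`
splits along `e₂`) — the box-compatibility hypothesis of ★ `apply_toRep_undoubleLoc_eq_of_box_transport`.
[cite: MoeglinVignerasWaldspurger1987, Chap. 2 II.1 Rem. (6)] [cite: Weil1964, n° 13, p. 160] -/
theorem frameOp_pd_boxSB (f₁ f₂ : SchwartzBruhat (Fin n → v.adicCompletion F)) :
    FrameTransport.frameOp F v (n + n) PD (boxSB (v.adicCompletion F) (e₂ n) f₁ f₂) =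
      boxSB (v.adicCompletion F) (e₂ n) (FrameTransport.frameOp F v n P f₁) (FrameTransport.frameOp F v n P f₂) := by
  apply Subtype.ext
  funext u
  rw [FrameTransport.coe_frameOp_apply, coe_boxSB, coe_boxSB]
  dsimp only
  rw [FrameTransport.coe_frameOp_apply, FrameTransport.coe_frameOp_apply, (resL_resR_frameLin_pd_symm F v n P hPD u).1,
    (resL_resR_frameLin_pd_symm F v n P hPD u).2]

/-! ## §3 `frameW_{PD}` preserves `ℓ_Δ` and `ℓ_Y`; movers transport -/

/-- a linear automorphism preserving a submodule in both directions fixes it: `e S ⊆ S`, `e⁻¹ S ⊆ S ⇒ e S = S`. [folklore] -/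
private theorem map_eq_of_mapsTo {K : Type*} [Field K] {M : Type*} [AddCommGroup M] [Module K M] (S : Submodule K M) (e : M ≃ₗ[K] M)
    (h₁ : ∀ x ∈ S, e x ∈ S) (h₂ : ∀ x ∈ S, e.symm x ∈ S) : S.map (e : M →ₗ[K] M) = S := by
  refine le_antisymm ?_ fun x hx => ⟨e.symm x, h₂ x hx, e.apply_symm_apply x⟩
  rintro _ ⟨x, hx, rfl⟩
  exact h₁ x hx

/-- **`frameW` preserves `ℓ_Y = 0 × F_vᴺ`** (any frame). [cite: MoeglinVignerasWaldspurger1987, Chap. 2 II Remarque (3)] -/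
theorem map_frameW_lagrangianY {N : ℕ} (Q : GL (Fin N) F) :
    (lagrangianY F N v).map ((FrameTransport.frameW F v N Q : ((Fin N → v.adicCompletion F) × (Fin N → v.adicCompletion F)) ≃ₗ[v.adicCompletion F]
        ((Fin N → v.adicCompletion F) × (Fin N → v.adicCompletion F))) :
        ((Fin N → v.adicCompletion F) × (Fin N → v.adicCompletion F)) →ₗ[v.adicCompletion F]
          ((Fin N → v.adicCompletion F) × (Fin N → v.adicCompletion F))) = lagrangianY F N v := by
  refine map_eq_of_mapsTo _ _ (fun x hx => ?_) (fun x hx => ?_)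
  · rw [lagrangianY, Submodule.mem_prod, Submodule.mem_bot] at hx ⊢
    refine ⟨?_, Submodule.mem_top⟩
    rw [FrameTransport.frameW_apply, hx.1, map_zero]
  · rw [lagrangianY, Submodule.mem_prod, Submodule.mem_bot] at hx ⊢
    refine ⟨?_, Submodule.mem_top⟩
    change (FrameTransport.frameLin F v N Q).symm x.1 = 0
    rw [hx.1, map_zero]

include hPD in
/-- the `e₂`-halves of `PD u` are `P (u|_L)`, `P (u|_R)` (read over `F_v`). [cite: Weil1964, n° 34] -/
theorem resL_resR_frameLin_pd (u : Fin (n + n) → v.adicCompletion F) :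
    resL (e₂ n) (FrameTransport.frameLin F v (n + n) PD u) = FrameTransport.frameLin F v n P (resL (e₂ n) u) ∧
      resR (e₂ n) (FrameTransport.frameLin F v (n + n) PD u) = FrameTransport.frameLin F v n P (resR (e₂ n) u) := by
  rw [FrameTransport.frameLin_apply, FrameTransport.frameLin_apply, FrameTransport.frameLin_apply, ← FrameTransport.coe_framePv,
    ← FrameTransport.coe_framePv, coe_framePv_pd F v n P hPD]
  exact resL_resR_reindex_fromBlocks_mulVec n _ _ u

include hPD in
/-- **`frameW_{PD}` preserves `ℓ_Δ`** (`PD = P ⊕ P` respects «both halves equal»). [cite: HarrisKudlaSweet1996, §1 (1.11)] [cite: Kudla1994, §2] -/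
theorem map_frameW_pd_deltaLagrangian :
    (deltaLagrangian F v n).map ((FrameTransport.frameW F v (n + n) PD :
        ((Fin (n + n) → v.adicCompletion F) × (Fin (n + n) → v.adicCompletion F)) ≃ₗ[v.adicCompletion F]
          ((Fin (n + n) → v.adicCompletion F) × (Fin (n + n) → v.adicCompletion F))) :
        ((Fin (n + n) → v.adicCompletion F) × (Fin (n + n) → v.adicCompletion F)) →ₗ[v.adicCompletion F]
          ((Fin (n + n) → v.adicCompletion F) × (Fin (n + n) → v.adicCompletion F))) = deltaLagrangian F v n := by
  refine map_eq_of_mapsTo _ _ (fun x hx => ?_) (fun x hx => ?_)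
  · rw [mem_deltaLagrangian_iff] at hx ⊢
    have h1 := resL_resR_frameLin_pd F v n P hPD x.1
    have h2 := resL_resR_frameLin_pd F v n P hPD x.2
    change resL (e₂ n) x.1 = resR (e₂ n) x.1 ∧ resL (e₂ n) x.2 = resR (e₂ n) x.2 at hx
    change resL (e₂ n) (FrameTransport.frameLin F v (n + n) PD x.1) = resR (e₂ n) (FrameTransport.frameLin F v (n + n) PD x.1) ∧
      resL (e₂ n) (FrameTransport.frameLin F v (n + n) PD x.2) = resR (e₂ n) (FrameTransport.frameLin F v (n + n) PD x.2)
    rw [h1.1, h1.2, h2.1, h2.2, hx.1, hx.2]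
    exact ⟨rfl, rfl⟩
  · rw [mem_deltaLagrangian_iff] at hx ⊢
    have h1 := resL_resR_frameLin_pd_symm F v n P hPD x.1
    have h2 := resL_resR_frameLin_pd_symm F v n P hPD x.2
    change resL (e₂ n) x.1 = resR (e₂ n) x.1 ∧ resL (e₂ n) x.2 = resR (e₂ n) x.2 at hx
    change resL (e₂ n) ((FrameTransport.frameLin F v (n + n) PD).symm x.1) = resR (e₂ n) ((FrameTransport.frameLin F v (n + n) PD).symm x.1) ∧
      resL (e₂ n) ((FrameTransport.frameLin F v (n + n) PD).symm x.2) = resR (e₂ n) ((FrameTransport.frameLin F v (n + n) PD).symm x.2)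
    rw [h1.1, h1.2, h2.1, h2.2, hx.1, hx.2]
    exact ⟨rfl, rfl⟩

include hPD in
/-- **`frameMp_{PD}` carries movers to movers**: if `π(m)` carries `ℓ_Δ` onto `ℓ_Y` in `𝕎^𝔻_{T₀'}`, then `π(frameMp_{PD} m) = frameW π(m) frameW⁻¹` carries
`ℓ_Δ` onto `ℓ_Y` in `𝕎^𝔻_{T₀}` — the «ANY mover» slot of ★ `parabolic_toRep_conj_localSplittingDatumCM`.
[cite: MoeglinVignerasWaldspurger1987, Chap. 2 II Remarque (3)] [cite: Kudla1994, Thm 3.1] -/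
theorem map_proj_frameMp_pd_deltaLagrangian
    (hDD : ((PD : Matrix (Fin (n + n)) (Fin (n + n)) F))ᵀ * gramD F n T₀ * (PD : Matrix (Fin (n + n)) (Fin (n + n)) F) = gramD F n T₀')
    (m : LocalMp F (n + n) (gramD F n T₀') v)
    (hm : (deltaLagrangian F v n).map (toLin F v (MpPsi.proj _ m)) = lagrangianY F (n + n) v) :
    (deltaLagrangian F v n).map (toLin F v (MpPsi.proj _ (FrameTransport.frameMp F v (n + n) PD hDD m))) = lagrangianY F (n + n) v := by
  rw [FrameTransport.proj_frameMp, FrameTransport.frameSp, toLin, coe_symplecticConj, LinearEquiv.coe_trans, LinearEquiv.coe_trans,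
    Submodule.map_comp, Submodule.map_comp]
  have h1 : (deltaLagrangian F v n).map (((FrameTransport.frameW F v (n + n) PD).symm :
      ((Fin (n + n) → v.adicCompletion F) × (Fin (n + n) → v.adicCompletion F)) ≃ₗ[v.adicCompletion F]
        ((Fin (n + n) → v.adicCompletion F) × (Fin (n + n) → v.adicCompletion F))) :
      ((Fin (n + n) → v.adicCompletion F) × (Fin (n + n) → v.adicCompletion F)) →ₗ[v.adicCompletion F]
        ((Fin (n + n) → v.adicCompletion F) × (Fin (n + n) → v.adicCompletion F))) = deltaLagrangian F v n := by
    conv_lhs => rw [← map_frameW_pd_deltaLagrangian F v n P hPD, ← Submodule.map_comp]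
    rw [← LinearEquiv.coe_trans, LinearEquiv.self_trans_symm, LinearEquiv.refl_toLinearMap, Submodule.map_id]
  rw [h1]
  change ((deltaLagrangian F v n).map (toLin F v (MpPsi.proj _ m))).map _ = _
  rw [hm, map_frameW_lagrangianY]



end Literature.NumberTheory.GelbartRogawski1991.UnitaryDualPair.LocalSplitting

end
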